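import Summits.QuantumFields.BalabanUV.Beta.GAN24.LegPushDressedBoundBlockL1
import Summits.QuantumFields.BalabanUV.Beta.GAN24.LegChainPushDressed
import Summits.QuantumFields.BalabanUV.Beta.GAN24.CarrierKernelLegBlockL1
import Summits.QuantumFields.BalabanUV.Beta.GAN24.DressedSlotLegSplit
import Summits.QuantumFields.BalabanUV.Beta.GAN24.LegWindowArithmetic
import Summits.QuantumFields.BalabanUV.Beta.GAN24.TransportMarginal

/-!
# `BalabanUV.Beta.GAN24.NaturalWindowH1` — binder row G-an2-4 ∕ (CONV-C), W-slot, the (α-0) parity re-cut, located crux (Q-L-k₀)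
# (RULING R-gan24p1-g36-1; OWNER `b2b-balaban-gan24-p1` gen 37, part 6 — THE SOCKET CALL (E-d)):
# **(H1♮) — THE k₀-FOLD WINDOW OF THE DRESSED COMB LEG CHAIN CONTRACTS, ON EVERY BOUNDED `LocStencil₂` TABLE WITH SLOT-CHARGE AND SLOT-DIVERGENCE ROWS.**

NOT IN PRINT; OUR BOOKKEEPING ([folklore] assembly BY NAME + the rate∕k₀ arithmetic; 0 `def`, 0 cited facts, 0 `def … : Prop`, 0 sorry).  HONEST FRAMING (cell contract,
verbatim): «discharging `BetaPertH` makes Bałaban's UV stability UNCONDITIONAL — a real constructive-QFT result; it is NOT the continuum limit and NOT the Clay problem.»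
HONEST DEPENDENCY (verbatim): «continuum YM on T⁴ ⇐ BetaPertH ∧ nine spine estimates (0/9 proved); BetaPertH ⇐ (D1) ∧ (D4) ∧ CAP+tail; G-an2-4 gates asym, D1 and NE2/3/4.»

WHAT (`d = 3`, `2 ≤ Lc`, the (α-0) pin `|c| ≤ Lc^{2(d+1)}`, `K♮ᴱ_j := unitK (sfStep Lc j) (smStep 3 Lc j) (coDressKBmAt (toSite rr) Lc (KInvStep Lc j))`, `kc _ := −(c·Lc^{2(d+1)}·(Lc^{d+1})⁻¹)`):
**`h1_window_of_dressed_comb`** — there is a rate ceiling `δ₁ > 0` such that for EVERY rate `0 < δ ≤ δ₁` there is a minimal length `kmin` such that for EVERY `k ≥ kmin`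
there are `0 ≤ θ < 1` and `Cg ≥ 0` with, for every in-block root `rr`, every start `n`, every table `W` bounded with `LocStencil₂ W C δ` whose three slot-CHARGE rows
(`Σ′_{v′} W`, `Σ′_v W`, `Σ′_v Σ′_{v′} W`) and two slot-DIVERGENCE rows (`Σ_μ (W … (w − e_μ) … − W … w …)` in either slot) are bounded by `g` at rate `δ`:
`LocStencil₂ (legChain kc K♮ᴱ Lc n (k+1) (bsumPow Lc (k+1) ∘ W)) (θ·C + Cg·g) δ`
— the binder `H1` of leaf-03's (Q-L) END (`LegTowerMemberRows` ∕ `LegRowsOnRuledClass.legRows_halfMember_of_ruledChain_rows`, `k₀ = k+1`) with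
`GoodL W g :≡` those five rows, the ruled-class membership `𝒫 W` NOT EVEN USED (RULING (2): «the ruled class is comfort, not load»).
HOW: leaf-01 g74's window `LegPushDressedBoundBlockL1.locStencil₂_legChain_bsumPow_of_dressed_envelopes_of_blockL1` fed with MY part 4 (`hK`, `hl₁`:
`CarrierKernelLegBlockL1`), MY part 5 (`hE hr hr′ hφ`: `DressedSlotLegSplit`), leaf-01's pin `LegChainPushDressed.abs_prod_kcPin_le`; the window's rate `κ₀ := 18(d+1)·δ`
(so its output rate `κ₀∕(18(d+1))` IS `δ` and the leg envelopes, valid at the legs' own rate `κ_leg = min(part 4's, part 5's)`, are read at `κ₀ ≤ κ_leg` — whence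
`δ₁ := κ_leg∕(18(d+1))`); the window's constant `|Πkc|·(C_bare + C_gauge)` is AFFINE in `(C, g)` and is re-packaged as `θ·C + Cg·g` with
`θ = L^{3(d+1)}·|Fib 3|·(d+1)²·(K″(k+1)L^{−1})·e^{κ₀}Zl(δ∕6)·(C′L^{−(d+3)})²·e^{2κ₀}(12∕δ·Zl(δ∕12))²·Zl(κ₀∕(2(d+1))) = Cθ(δ)·(k+1)·(Lc⁻¹)^{k+1}` (`L = Lc^{k+1}`; THE RULING's POWER
LEDGER `L^{d−4} = L^{−1}`: pin `+3(d+1)`, kernel-leg block mass `−1`, two gradient-type slot legs `−2(d+3)`, one block volume `+(d+1)`), and `kmin` is MY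
`LegWindowArithmetic` (`eventually_contraction_lt_one` ∧ `eventually_gap`: `Cθ(δ)·(k+1)·(Lc⁻¹)^{k+1} < 1` ∧ `6κ₀ ≤ δ·Lc^{k+1}`).
WHAT IT DOES NOT DO: it is stated for EVERY `δ ≤ δ₁` and every `k ≥ kmin(δ)`; the (Q-L) END must pick ONE `(δ, k₀)` at which ALSO (H0)∕(H0d) (leaf-03 FILE 6: every
`δ ≤ δ₀(k₀)`), (H2)∕(H2d) (leaf-03 g68: the same windows, `q < k₀`) and (H3)∕(H3d) hold — the quantifier order `δ₀(k₀)` vs `kmin(δ)` is the END's (a `k₀`-uniform `δ₀`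
suffices).  NOT (Q-L) ∕ (C)sym; NEVER «G-an2-4 closed» as (CONV-C); NOT D1, NOT `BetaPertH`, NOT continuum, NOT Clay; not in print.
Unit `b2b-balaban-gan24-p1` (BINDER row G-an2-4 OWNER; CRUX PROVER on C-R8° CT-ROUTE), gen 37, 2026-08-23.
v1.1 (gen 41, 2026-08-24): `exp_neg_mul_le_of_le` BY NAME (dedup).  v1.2 (gen 43, 2026-08-24): `set_option maxHeartbeats 400000 in` on `h1_window_of_dressed_comb` (heartbeat headroom for the hub build; 180k FAIL ∕ 200k PASS measured); statements and proofs unchanged.  v1.3 (gen 43): the helper `nonneg_of_row` dropped for the tree's `TaylorBlockSum.nonneg_of_dominated` BY NAME (one call site); `h1_window_of_dressed_comb` statement unchanged, proof otherwise byte-identical.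
-/

noncomputable section

open Finset Filter
open scoped BigOperators
open Literature.MathematicalPhysics.QuantumFieldTheory
open Literature.MathematicalPhysics.QuantumFieldTheory.LatticeForm (quo)
open Literature.MathematicalPhysics.QuantumFieldTheory.Balaban1983to89
open Literature.MathematicalPhysics.QuantumFieldTheory.Balaban1983to89.Beta
open B4ContourShift (supNorm supNorm_nonneg)
open B6BondElimination (unitVec)
open B12Sec2to5 (l1 l1_nonneg)
open ExpKernelCalculus (MKer Decays Zl Zl_nonneg Zl_pos)
open OneStepResolventKernel (Fib)
open OneStepKernelFamily (KInvStep colH)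
open AffineAveraging (Site box toSite)
open BalabanCompositeJets (LocStencil₂ LocStencil₂.nonneg respStep)
open Summit.QuantumFields.BalabanUV.Beta.AxialProjectorBlockMean (bmGaugeAt)
open Summit.QuantumFields.BalabanUV.Beta.GAN24.RespStepBmDecompLegs (legAct)
open Summit.QuantumFields.BalabanUV.Beta.GAN24.RespStepBmDecompPsi (Psi)
open Summit.QuantumFields.BalabanUV.Beta.HessKerDressedUnits (unitK)
open Summit.QuantumFields.BalabanUV.Beta.AxialDressingRooted (coDressKBmAt)
open Summit.QuantumFields.BalabanUV.Beta.GAN24.CombesThomas (sfStep smStep)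
open Summit.QuantumFields.BalabanUV.Beta.GAN24.BiStencilZeroMode (Tab)
open Summit.QuantumFields.BalabanUV.Beta.GAN24.Lin4LegTowerUnroll (bsumPow)
open Summit.QuantumFields.BalabanUV.Beta.GAN24.TransportMarginal (locStencil₂_weaken)
open Summit.QuantumFields.BalabanUV.Beta.GAN24.LegStepPush (krow)
open Summit.QuantumFields.BalabanUV.Beta.GAN24.LegChainPush (kChain)
open Summit.QuantumFields.BalabanUV.Beta.GAN24.LegChainPushDressed (abs_prod_kcPin_le)
open Summit.QuantumFields.BalabanUV.Beta.GAN24.LegPushDressedBoundBlockL1 (locStencil₂_legChain_bsumPow_of_dressed_envelopes_of_blockL1)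
open Summit.QuantumFields.BalabanUV.Beta.GAN24.CarrierKernelLegBlockL1 (decays_dressedStep exists_kChain_dressed_blockMass)
open Summit.QuantumFields.BalabanUV.Beta.GAN24.DressedSlotLegSplit (legChain_dressed_colH_eq exists_dressed_slotLeg_envelopes)
open Summit.QuantumFields.BalabanUV.Beta.GAN24.LegWindowArithmetic (eventually_contraction_lt_one eventually_gap)
-- v1.1: the rate-weakening one-liner is the tree's `FineReadoutGradientDecay.exp_neg_mul_le_of_le` (transitively imported), called BY NAME — v1 re-declared its printed statement (`dedup.landed`).
open Summit.QuantumFields.BalabanUV.Beta.GAN24.FineReadoutGradientDecay (exp_neg_mul_le_of_le)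
-- v1.3: the slot-charge-row one-liner `0 < e → |a| ≤ g * e → 0 ≤ g` is the tree's `TaylorBlockSum.nonneg_of_dominated` (transitively imported), called BY NAME — v1 ∕ v1.1 ∕ v1.2 re-declared it as `nonneg_of_row` (a binder-permuted restatement; `dedup.landed` risk).
open Summit.QuantumFields.BalabanUV.Beta.GAN24.TaylorBlockSum (nonneg_of_dominated)

namespace Summit.QuantumFields.BalabanUV.Beta.GAN24.NaturalWindowH1

variable {Lc : ℕ} [NeZero Lc]

-- v1.2: heartbeat HEADROOM ONLY — `h1_window_of_dressed_comb` needs between 180 000 and 200 000 heartbeats (OWNER gen-43 current-bytes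
-- window-chain cert: FAIL at a global 170 000 ∕ 180 000, PASS at 200 000), i.e. < 10 % margin under the default budget = the hub `lake build` cliff class
-- (ops-buildfix; leaf-06 g58 A-3): pre-emptive `set_option maxHeartbeats 400000 in`.  Statement and proof BYTE-IDENTICAL to v1.1.
set_option maxHeartbeats 400000 in
/-- NOT IN PRINT; OUR BOOKKEEPING.  **(H1♮): THE k₀-FOLD WINDOW OF THE DRESSED COMB LEG CHAIN CONTRACTS** (as displayed in the module docstring). -/
theorem h1_window_of_dressed_comb (hLc : 2 ≤ Lc) {c : ℝ} (hc : |c| ≤ (Lc : ℝ) ^ (2 * (3 + 1))) :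
    ∃ δ₁ : ℝ, 0 < δ₁ ∧ ∀ δ : ℝ, 0 < δ → δ ≤ δ₁ → ∃ kmin : ℕ, ∀ k : ℕ, kmin ≤ k →
      ∃ θ Cg : ℝ, 0 ≤ θ ∧ θ < 1 ∧ 0 ≤ Cg ∧ ∀ (rr : Fin (3 + 1) → ℕ), rr ∈ box (3 + 1) Lc →
        ∀ (n : ℕ) (W : Tab 3) (C g : ℝ),
          (∃ B : ℝ, ∀ κ u κ' u' x z a b, |W κ u κ' u' x z a b| ≤ B) → LocStencil₂ W C δ →
          (∀ (κ₁ : Fin (3 + 1)) (v : Site (3 + 1)) (κ₂ : Fin (3 + 1)) (x p : Site (3 + 1)) (f b : Fib 3),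
              |∑' v', W κ₁ v κ₂ v' x p f b| ≤ g * Real.exp (-δ * (l1 (x - v) + l1 (p - v)))) →
          (∀ (κ₁ κ₂ : Fin (3 + 1)) (v' x p : Site (3 + 1)) (f b : Fib 3),
              |∑' v, W κ₁ v κ₂ v' x p f b| ≤ g * Real.exp (-δ * (l1 (x - v') + l1 (p - v')))) →
          (∀ (κ₁ κ₂ : Fin (3 + 1)) (x p : Site (3 + 1)) (f b : Fib 3),
              |∑' v, ∑' v', W κ₁ v κ₂ v' x p f b| ≤ g * Real.exp (-δ * l1 (p - x))) →
          (∀ (κ : Fin (3 + 1)) (v w x p : Site (3 + 1)) (f b : Fib 3),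
              |∑ μ, (W κ v μ (w - unitVec μ) x p f b - W κ v μ w x p f b)|
                ≤ g * Real.exp (-δ * l1 (w - v)) * Real.exp (-δ * (l1 (x - v) + l1 (p - v)))) →
          (∀ (κ' : Fin (3 + 1)) (w v' x p : Site (3 + 1)) (f b : Fib 3),
              |∑ κ, (W κ (w - unitVec κ) κ' v' x p f b - W κ w κ' v' x p f b)|
                ≤ g * Real.exp (-δ * l1 (v' - w)) * Real.exp (-δ * (l1 (x - w) + l1 (p - w)))) →
          LocStencil₂
            (Lin4LegTowerUnroll.legChain (fun _ : ℕ => -((c * (Lc : ℝ) ^ (2 * (3 + 1))) * ((Lc : ℝ) ^ (3 + 1))⁻¹))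
              (fun j => unitK (sfStep Lc j) (smStep 3 Lc j) (coDressKBmAt (toSite rr) Lc (KInvStep (d := 3) Lc j))) Lc n (k + 1)
              (fun κ u κ' u' => bsumPow Lc (k + 1) (W κ u κ' u')))
            (θ * C + Cg * g) δ := by
  classical
  have hLc1 : 1 ≤ Lc := le_trans (by norm_num) hLc
  have hLpos : (0 : ℝ) < (Lc : ℝ) := by exact_mod_cast (show 0 < Lc by omega)
  have hL1 : (1 : ℝ) ≤ Lc := by exact_mod_cast hLc1
  -- the leg letters
  obtain ⟨κa, K'', hκa, hK'', hBM⟩ := exists_kChain_dressed_blockMass (Lc := Lc) hLc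
  obtain ⟨κb, Cr, Cr', Cφ, hκb, hCr, hCr', hCφ, hENV⟩ := exists_dressed_slotLeg_envelopes (Lc := Lc) hLc
  -- the rate ceiling
  set κl : ℝ := min κa κb with hκl
  have hκl0 : 0 < κl := lt_min hκa hκb
  refine ⟨κl / (18 * (((3 : ℕ) : ℝ) + 1)), by positivity, ?_⟩
  intro δ hδ hδ₁
  set κ₀ : ℝ := 18 * (((3 : ℕ) : ℝ) + 1) * δ with hκ₀
  have hκ₀0 : 0 < κ₀ := by positivity
  have hκ₀l : κ₀ ≤ κl := by
    rw [hκ₀]; have := mul_le_mul_of_nonneg_left hδ₁ (show (0 : ℝ) ≤ 18 * (((3 : ℕ) : ℝ) + 1) by positivity)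
    calc 18 * (((3 : ℕ) : ℝ) + 1) * δ ≤ 18 * (((3 : ℕ) : ℝ) + 1) * (κl / (18 * (((3 : ℕ) : ℝ) + 1))) := this
      _ = κl := by field_simp
  have hκ₀a : κ₀ ≤ κa := hκ₀l.trans (min_le_left _ _)
  have hκ₀b : κ₀ ≤ κb := hκ₀l.trans (min_le_right _ _)
  -- the δ-dependent lattice constants
  have hZ6 := Zl_nonneg (D := 3 + 1) (show 0 < δ / 6 by positivity)
  have hZ12 := Zl_nonneg (D := 3 + 1) (show 0 < δ / 6 / 2 by positivity)
  have hZ2 := Zl_nonneg (D := 3 + 1) (show 0 < δ / 2 by positivity)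
  have hZκ := Zl_nonneg (D := 3 + 1) (show 0 < κ₀ / (2 * (((3 : ℕ) : ℝ) + 1)) by positivity)
  set X : ℝ := 2 / (δ / 6) * Zl (3 + 1) (δ / 6 / 2) with hX
  have hX0 : 0 ≤ X := by rw [hX]; positivity
  -- the contraction constant `Cθ(δ)`
  set Cθ : ℝ := (Fintype.card (Fib 3) : ℝ) * (((3 : ℕ) : ℝ) + 1) ^ 2 * K'' * (Real.exp κ₀ * Zl (3 + 1) (δ / 6)) *
      (Cr' ^ 2 * Real.exp κ₀ ^ 2 * X ^ 2) * Zl (3 + 1) (κ₀ / (2 * (((3 : ℕ) : ℝ) + 1))) with hCθ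
  -- choose the window length: contraction AND the transfer gap
  have hev := ((eventually_contraction_lt_one hLc Cθ 1).and (eventually_gap hLc 6 κ₀ hδ)).and (eventually_ge_atTop 1)
  obtain ⟨kmin, hkmin⟩ := Filter.eventually_atTop.1 hev
  refine ⟨kmin, fun k hk => ?_⟩
  obtain ⟨⟨hcontr, hgap6⟩, -⟩ := hkmin (k + 1) (by omega)
  -- the blocking and the envelopes at this length
  set Lr : ℝ := (Lc : ℝ) ^ (k + 1) with hLr
  have hLr0 : 0 < Lr := by rw [hLr]; positivity
  have hLcast : (((Lc ^ (k + 1) : ℕ) : ℝ)) = Lr := by rw [hLr, Nat.cast_pow]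
  set a : ℝ := Cr * ((Lc : ℝ) ^ (5 * (k + 1)))⁻¹ with ha
  set a' : ℝ := Cr' * ((Lc : ℝ) ^ (6 * (k + 1)))⁻¹ with ha'
  set aφ : ℝ := Cφ * ((Lc : ℝ) ^ (4 * (k + 1)))⁻¹ with haφ
  set aρ : ℝ := K'' * ((k : ℝ) + 1) * ((Lc : ℝ) ^ (k + 1))⁻¹ * ((((Lc ^ (k + 1) : ℕ) : ℝ)) ^ (3 + 1))⁻¹ with haρ
  have ha0 : 0 ≤ a := by rw [ha]; positivity
  have ha'0 : 0 ≤ a' := by rw [ha']; positivity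
  have haφ0 : 0 ≤ aφ := by rw [haφ]; positivity
  have haρ0 : 0 ≤ aρ := by rw [haρ]; positivity
  set P : ℝ := (((Lc ^ (k + 1) : ℕ) : ℝ)) ^ (3 * (3 + 1)) with hP
  have hP0 : 0 ≤ P := by rw [hP]; positivity
  -- θ and Cg
  set θ : ℝ := P * ((Fintype.card (Fib 3) : ℝ) * (((3 : ℕ) : ℝ) + 1) ^ 2 *
      (aρ * ((Real.exp κ₀ * Zl (3 + 1) (δ / 6)) * (a' ^ 2 * Real.exp κ₀ ^ 2 * X ^ 2)) *
        ((((Lc ^ (k + 1) : ℕ) : ℝ)) ^ (3 + 1) * Zl (3 + 1) (κ₀ / (2 * (((3 : ℕ) : ℝ) + 1)))))) with hθ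
  have hθ0 : 0 ≤ θ := by rw [hθ]; positivity
  -- the power count: θ = Cθ·(k+1)·(Lc⁻¹)^{k+1}
  have hθeq : θ = Cθ * (((k + 1 : ℕ) : ℝ)) ^ 1 * ((Lc : ℝ)⁻¹) ^ (k + 1) := by
    have e6 : (Lc : ℝ) ^ (6 * (k + 1)) = Lr ^ 6 := by rw [hLr, ← pow_mul, mul_comm]
    have e3 : (((Lc ^ (k + 1) : ℕ) : ℝ)) ^ (3 * (3 + 1)) = Lr ^ 12 := by rw [hLcast]
    have e4 : (((Lc ^ (k + 1) : ℕ) : ℝ)) ^ (3 + 1) = Lr ^ 4 := by rw [hLcast]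
    have eL : ((Lc : ℝ)⁻¹) ^ (k + 1) = Lr⁻¹ := by rw [hLr, inv_pow]
    have hLrne : Lr ≠ 0 := hLr0.ne'
    rw [hθ, hP, haρ, ha', hCθ, e3, e4, e6, eL, ← hLr, pow_one]
    push_cast
    field_simp
  have hθ1 : θ < 1 := by rw [hθeq]; exact hcontr
  set Cg : ℝ := P * ((Fintype.card (Fib 3) : ℝ) * (((3 : ℕ) : ℝ) + 1) ^ 2 *
      (aρ * ((Real.exp κ₀ * Zl (3 + 1) (δ / 6)) * (2 * (a * a' * Real.exp κ₀ * X) + a ^ 2)) *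
        ((((Lc ^ (k + 1) : ℕ) : ℝ)) ^ (3 + 1) * Zl (3 + 1) (κ₀ / (2 * (((3 : ℕ) : ℝ) + 1)))))
      + (Fintype.card (Fib 3) : ℝ) * (aρ * ((((3 : ℕ) : ℝ) + 1) * (2 * (a * aφ) + aφ * aφ * (Real.exp δ ^ 3 + 1))) *
        (Real.exp κ₀ ^ 5 * Zl (3 + 1) (δ / 2) ^ 3 * ((((Lc ^ (k + 1) : ℕ) : ℝ)) ^ (3 + 1) * Zl (3 + 1) (κ₀ / (2 * (((3 : ℕ) : ℝ) + 1))))))) with hCg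
  have hCg0 : 0 ≤ Cg := by rw [hCg]; positivity
  refine ⟨θ, Cg, hθ0, hθ1, hCg0, ?_⟩
  intro rr hrr n W C g hB hW hq₂ hq₁ hq₁₂ hD₂ hD₁
  obtain ⟨B, hWb⟩ := hB
  have hg : 0 ≤ g := nonneg_of_dominated (Real.exp_pos _) (hq₁₂ 0 0 0 0 (Sum.inl 0) (Sum.inl 0))
  have hC0 : 0 ≤ C := hW.nonneg
  -- the gap `κ₀ ≤ (δ/6)·L` at `L = Lc^{k+1}`
  have hgap : κ₀ ≤ δ / 6 * ((Lc ^ (k + 1) : ℕ) : ℝ) := by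
    rw [hLcast, hLr]; linarith
  -- the leg inputs at rate κ₀
  obtain ⟨hr0, hr'0, hφ0⟩ := hENV rr hrr n k
  have hE := legChain_dressed_colH_eq (d := 3) hrr n k
  have hr : ∀ (μ : Fin (3 + 1)) (y : Site (3 + 1)) (κ : Fin (3 + 1)) (v : Site (3 + 1)),
      |respStep (d := 3) (Lc ^ n) (Lc ^ (n + k + 1)) μ y κ v|
        ≤ a * Real.exp (-(κ₀ * supNorm (quo (Lc ^ (k + 1)) v - y))) := fun μ y κ v =>
    (hr0 μ y κ v).trans (mul_le_mul_of_nonneg_left (exp_neg_mul_le_of_le hκ₀b (supNorm_nonneg _)) ha0)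
  have hr' : ∀ (μ : Fin (3 + 1)) (y : Site (3 + 1)) (κ : Fin (3 + 1)) (v : Site (3 + 1)) (i : Fin (3 + 1)),
      |respStep (d := 3) (Lc ^ n) (Lc ^ (n + k + 1)) μ y κ (v + Pi.single i 1)
          - respStep (d := 3) (Lc ^ n) (Lc ^ (n + k + 1)) μ y κ v|
        ≤ a' * Real.exp (-(κ₀ * supNorm (quo (Lc ^ (k + 1)) v - y))) := fun μ y κ v i =>
    (hr'0 μ y κ v i).trans (mul_le_mul_of_nonneg_left (exp_neg_mul_le_of_le hκ₀b (supNorm_nonneg _)) ha'0)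
  have hφ : ∀ (μ : Fin (3 + 1)) (y v : Site (3 + 1)),
      |(fun (μ : Fin (3 + 1)) (y v : Site (3 + 1)) =>
          Psi (toSite rr) Lc n k (fun μ' y' => if μ' = μ then (if y' = y then (1 : ℝ) else 0) else 0) v
            - bmGaugeAt (toSite rr)
                (legAct (respStep (d := 3) (Lc ^ n) (Lc ^ (n + k + 1)))
                  (fun μ' y' => if μ' = μ then (if y' = y then (1 : ℝ) else 0) else 0)) Lc v) μ y v|
        ≤ aφ * Real.exp (-(κ₀ * supNorm (quo (Lc ^ (k + 1)) v - y))) := fun μ y v =>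
    (hφ0 μ y v).trans (mul_le_mul_of_nonneg_left (exp_neg_mul_le_of_le hκ₀b (supNorm_nonneg _)) haφ0)
  have hl₁ : ∀ (α : Fin (3 + 1)) (x' : Site (3 + 1)) (f : Fib 3) (c' : Site (3 + 1)),
      ∑ t ∈ box (3 + 1) (Lc ^ (k + 1)),
          |kChain (fun j => krow (unitK (sfStep Lc j) (smStep 3 Lc j) (coDressKBmAt (toSite rr) Lc (KInvStep (d := 3) Lc j))) Lc) n k α x' f
              (((Lc ^ (k + 1) : ℕ) : ℤ) • c' + toSite t)|
        ≤ aρ * (((Lc ^ (k + 1) : ℕ) : ℝ)) ^ (3 + 1) * Real.exp (-(κ₀ * supNorm (c' - x'))) := by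
    intro α x' f c'
    refine (hBM rr hrr n k α x' f c').trans ?_
    have e : aρ * (((Lc ^ (k + 1) : ℕ) : ℝ)) ^ (3 + 1) = K'' * ((k : ℝ) + 1) * ((Lc : ℝ) ^ (k + 1))⁻¹ := by
      rw [haρ]
      have hne : (((Lc ^ (k + 1) : ℕ) : ℝ)) ^ (3 + 1) ≠ 0 := by rw [hLcast]; positivity
      field_simp
    rw [e]
    exact mul_le_mul_of_nonneg_left (exp_neg_mul_le_of_le hκ₀a (supNorm_nonneg _)) (by positivity)
  -- the window
  have R := locStencil₂_legChain_bsumPow_of_dressed_envelopes_of_blockL1 (d := 3)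
    (K := fun j => unitK (sfStep Lc j) (smStep 3 Lc j) (coDressKBmAt (toSite rr) Lc (KInvStep (d := 3) Lc j)))
    (kc := fun _ : ℕ => -((c * (Lc : ℝ) ^ (2 * (3 + 1))) * ((Lc : ℝ) ^ (3 + 1))⁻¹))
    (r := respStep (d := 3) (Lc ^ n) (Lc ^ (n + k + 1)))
    (φ := fun (μ : Fin (3 + 1)) (y v : Site (3 + 1)) =>
      Psi (toSite rr) Lc n k (fun μ' y' => if μ' = μ then (if y' = y then (1 : ℝ) else 0) else 0) v
        - bmGaugeAt (toSite rr) (legAct (respStep (d := 3) (Lc ^ n) (Lc ^ (n + k + 1)))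
            (fun μ' y' => if μ' = μ then (if y' = y then (1 : ℝ) else 0) else 0)) Lc v)
    hLc1 (decays_dressedStep (d := 3) hrr) hW hδ n k (L := Lc ^ (k + 1)) rfl hκ₀0 hgap
    ha0 ha'0 haφ0 haρ0 hg hg hE hr hr' hφ hl₁ hWb hq₂ hq₁ hq₁₂ hD₂ hD₁
  -- re-package the constant and the rate
  have hpin := abs_prod_kcPin_le (d := 3) hLc1 hc n k
  refine locStencil₂_weaken R ?_ ?_
  · -- `|Πkc|·(C_bare + C_gauge) ≤ P·(…) = θ·C + Cg·g`
    have hS : 0 ≤ (Fintype.card (Fib 3) : ℝ) * (((3 : ℕ) : ℝ) + 1) ^ 2 *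
          (aρ * ((Real.exp κ₀ * Zl (3 + 1) (δ / 6)) *
            (a' ^ 2 * C * Real.exp κ₀ ^ 2 * (2 / (δ / 6) * Zl (3 + 1) (δ / 6 / 2)) ^ 2
              + 2 * (a * a' * g * Real.exp κ₀ * (2 / (δ / 6) * Zl (3 + 1) (δ / 6 / 2))) + a ^ 2 * g)) *
          ((((Lc ^ (k + 1) : ℕ) : ℝ)) ^ (3 + 1) * Zl (3 + 1) (κ₀ / (2 * (((3 : ℕ) : ℝ) + 1)))))
         + (Fintype.card (Fib 3) : ℝ) * (aρ * g * ((((3 : ℕ) : ℝ) + 1) * (2 * (a * aφ) + aφ * aφ * (Real.exp δ ^ 3 + 1))) *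
          (Real.exp κ₀ ^ 5 * Zl (3 + 1) (δ / 2) ^ 3 * ((((Lc ^ (k + 1) : ℕ) : ℝ)) ^ (3 + 1) * Zl (3 + 1) (κ₀ / (2 * (((3 : ℕ) : ℝ) + 1)))))) := by
      positivity
    refine (mul_le_mul_of_nonneg_right hpin hS).trans (le_of_eq ?_)
    rw [hθ, hCg, hP, hX]
    ring
  · -- the rate: `δ ≤ κ₀/3/(6(d+1))` (equality)
    have : δ = κ₀ / 3 / (6 * (((3 : ℕ) : ℝ) + 1)) := by rw [hκ₀]; field_simp; ring
    exact this.le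

end Summit.QuantumFields.BalabanUV.Beta.GAN24.NaturalWindowH1

end
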